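import Summits.Ventures.PercRepro.RankLevelSetCorankFiveSets
import Summits.Ventures.PercRepro.RankLevelSetTheoremCFull

/-!
# PercRepro — C-025 at `q = 3` on the core of corank `5`, for every `p ≥ 14` (night-1, gen 2; sharp `d = 5`, part 3 of 3)

With the plane-section counts of RankLevelSetCorankFivePlanes / RankLevelSetCorankFiveSets (`#U ≤ C(n,3) + (25n + 70) + 810`,
`#{r ≤ 3} ≤ Σ_{j≤3} C(n,j) + (25n + 70) + 4050`) in place of the crude `C(20,5)` and `2^20` of RankLevelSetCorankFive,
the inequality `Φ(p,3)·#U ≤ #Y` holds on the core of corank `5` for every `n = p + 5 ≥ 19` (ratio `0.90` at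
`n = 19`, `1.03` at `n = 18`) — the same induction as `corank_five_arith`.

* `corank_five_arith_sharp` — the arithmetic from `n = 19`;
* **`c025_core_corank_five_simple_sharp`** — the inequality on the core of corank `5`, `|E| ≥ 19`;
* **`c025_core_corank_five_sharp`** — the `d = 5` cell of `SmallCoreCells'` for every `p ≥ 14`.
Axioms: standard.
-/

namespace PercRepro

/-! ### The arithmetic from `n = 19` -/

/-- **The corank-`5` arithmetic with the sharp counts**, for every `n ≥ 19`:
`2^{n−2}·(C(n,3) + 25n + 70 + 810) + C(n−2,3)·(Σ_{j<4} C(n,j) + 25n + 70 + 4050 + Σ_{j<6} C(n,j)) ≤ 2^n·C(n−2,3)`. -/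
theorem corank_five_arith_sharp (n : ℕ) (hn : 19 ≤ n) :
    2 ^ (n - 2) * (n.choose 3 + (25 * n + 70) + 810) +
      (n - 2).choose 3 * ((∑ j ∈ Finset.range 4, n.choose j) + (25 * n + 70) + 4050 +
        ∑ j ∈ Finset.range 6, n.choose j) ≤ 2 ^ n * (n - 2).choose 3 := by
  induction n, hn using Nat.le_induction with
  | base =>
    simp only [Finset.sum_range_succ, Finset.sum_range_zero]
    norm_num [Nat.choose_eq_factorial_div_factorial, Nat.factorial]
  | succ n hn ih =>
    obtain ⟨m, rfl⟩ : ∃ m, n = m + 5 := ⟨n - 5, by omega⟩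
    have e1 : m + 5 - 2 = m + 3 := by omega
    have e2 : m + 5 + 1 - 2 = m + 4 := by omega
    rw [e1] at ih
    rw [e2]
    have h3 : 6 * (m + 3).choose 3 = (m + 1) * (m + 2) * (m + 3) := six_mul_choose_three m
    have h4 : 6 * (m + 4).choose 3 = (m + 2) * (m + 3) * (m + 4) := six_mul_choose_three (m + 1)
    have h5 : 6 * (m + 5).choose 3 = (m + 3) * (m + 4) * (m + 5) := six_mul_choose_three (m + 2)
    have h6 : 6 * (m + 5 + 1).choose 3 = (m + 4) * (m + 5) * (m + 6) := six_mul_choose_three (m + 3)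
    have hE1 : (m + 1) * (m + 4).choose 3 = (m + 4) * (m + 3).choose 3 := by
      have : 6 * ((m + 1) * (m + 4).choose 3) = 6 * ((m + 4) * (m + 3).choose 3) := by
        calc 6 * ((m + 1) * (m + 4).choose 3) = (m + 1) * (6 * (m + 4).choose 3) := by ring
          _ = (m + 1) * ((m + 2) * (m + 3) * (m + 4)) := by rw [h4]
          _ = (m + 4) * ((m + 1) * (m + 2) * (m + 3)) := by ring
          _ = (m + 4) * (6 * (m + 3).choose 3) := by rw [h3]
          _ = 6 * ((m + 4) * (m + 3).choose 3) := by ring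
      omega
    have hE2 : (m + 1) * (m + 5 + 1).choose 3 ≤ (m + 4) * (m + 5).choose 3 := by
      have : 6 * ((m + 1) * (m + 5 + 1).choose 3) ≤ 6 * ((m + 4) * (m + 5).choose 3) := by
        calc 6 * ((m + 1) * (m + 5 + 1).choose 3) = (m + 1) * (6 * (m + 5 + 1).choose 3) := by ring
          _ = (m + 1) * ((m + 4) * (m + 5) * (m + 6)) := by rw [h6]
          _ ≤ (m + 4) * ((m + 3) * (m + 4) * (m + 5)) := by nlinarith
          _ = (m + 4) * (6 * (m + 5).choose 3) := by rw [h5]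
          _ = 6 * ((m + 4) * (m + 5).choose 3) := by ring
      omega
    have hS4 := sum_choose_succ_le_general (m + 5) 4
    have hS6 := sum_choose_succ_le_general (m + 5) 6
    set X := 2 ^ (m + 3) with hX
    set S4 := ∑ j ∈ Finset.range 4, (m + 5).choose j with hS4def
    set S6 := ∑ j ∈ Finset.range 6, (m + 5).choose j with hS6def
    set S4' := ∑ j ∈ Finset.range 4, (m + 5 + 1).choose j with hS4'def
    set S6' := ∑ j ∈ Finset.range 6, (m + 5 + 1).choose j with hS6'def
    set c3 := (m + 3).choose 3 with hc3
    set c4 := (m + 4).choose 3 with hc4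
    set c5 := (m + 5).choose 3 with hc5
    set c6 := (m + 5 + 1).choose 3 with hc6
    have hp0 : 2 ^ (m + 4) = 2 * X := by rw [hX, pow_succ]; ring
    have hp1 : 2 ^ (m + 5) = 4 * X := by rw [hX, pow_succ, pow_succ]; ring
    have hp2 : 2 ^ (m + 5 + 1) = 8 * X := by rw [hX, pow_succ, pow_succ, pow_succ]; ring
    rw [hp1] at ih
    rw [hp0, hp2]
    have key : (m + 1) * (2 * X * (c6 + (25 * (m + 5 + 1) + 70) + 810) +
        c4 * (S4' + (25 * (m + 5 + 1) + 70) + 4050 + S6')) ≤ (m + 1) * (8 * X * c4) := by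
      have hA := Nat.mul_le_mul_left (2 * (m + 4)) ih
      have hB := Nat.mul_le_mul_left ((m + 4) * c3) hS4
      have hB' := Nat.mul_le_mul_left ((m + 4) * c3) hS6
      have hC := Nat.mul_le_mul_left (2 * X) hE2
      have hD : 2 * X * ((m + 1) * (25 * (m + 5 + 1) + 70 + 810)) ≤
          2 * X * ((m + 4) * (25 * (m + 5) + 70 + 810)) := by
        apply Nat.mul_le_mul_left
        nlinarith
      have hE1' : c4 * (S4' + (25 * (m + 5 + 1) + 70) + 4050 + S6') * (m + 1) =
          (m + 4) * c3 * (S4' + (25 * (m + 5 + 1) + 70) + 4050 + S6') := by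
        calc c4 * (S4' + (25 * (m + 5 + 1) + 70) + 4050 + S6') * (m + 1)
            = (S4' + (25 * (m + 5 + 1) + 70) + 4050 + S6') * ((m + 1) * c4) := by ring
          _ = (S4' + (25 * (m + 5 + 1) + 70) + 4050 + S6') * ((m + 4) * c3) := by rw [hE1]
          _ = (m + 4) * c3 * (S4' + (25 * (m + 5 + 1) + 70) + 4050 + S6') := by ring
      have hE1'' : (m + 1) * (8 * X * c4) = 2 * (m + 4) * (4 * X * c3) := by
        calc (m + 1) * (8 * X * c4) = 8 * X * ((m + 1) * c4) := by ring
          _ = 8 * X * ((m + 4) * c3) := by rw [hE1]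
          _ = 2 * (m + 4) * (4 * X * c3) := by ring
      have hlin : (m + 4) * c3 * (25 * (m + 5 + 1) + 70 + 4050) ≤
          (m + 4) * c3 * (2 * (25 * (m + 5) + 70 + 4050)) := by
        apply Nat.mul_le_mul_left
        omega
      linarith [hA, hB, hB', hC, hD, hE1', hE1'', hlin]
    exact Nat.le_of_mul_le_mul_left key (by omega)

namespace Matroid

/-- **C-025 at `q = 3` on the core of corank `5`, `|E| ≥ 19`** (the inequality form). -/
theorem c025_core_corank_five_simple_sharp {α : Type} (M : _root_.Matroid α) [M.Finite] (p : ℕ)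
    (hn : 19 ≤ M.E.ncard) (hd : M.E.encard = M.eRank + 5) (hR : M.eRank = (p : ℕ∞))
    (hs : ∀ e ∈ M.E, ∀ f ∈ M.E, e ≠ f → M.eRk {e, f} = 2)
    (hfree : ∀ e ∈ M.E, ∃ A ⊆ M.E \ {e}, e ∉ M.closure A ∧ e ∉ M.closure ((M.E \ {e}) \ A))
    (hcirc : ∀ C, M.IsCircuit C → 3 ≤ C.encard) :
    phiK p 3 * (Matroid.topCount M p 3 : ℚ) ≤ (Matroid.midCount M p 3 : ℚ) := by
  classical
  set n := M.E.ncard with hn_def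
  have hEcard : M.ground_finite.toFinset.card = n := by
    rw [hn_def, Set.ncard_eq_toFinset_card _ M.ground_finite]
  have hnpd : n = p + 5 := by
    have h := hd
    rw [← M.ground_finite.cast_ncard_eq, hR] at h
    exact_mod_cast h
  have hs3 : (Matroid.circuitsEq M 3).ncard ≤ 25 := ncard_circuitsEq_three_le_corank_five_core hs hfree hd
  have hs4 : (Matroid.circuitsEq M 4).ncard ≤ 70 := ncard_circuitsEq_four_le_corank_five hd
  have hU : Matroid.topCount M p 3 ≤ n.choose 3 + (25 * n + 70) + 810 := by
    have h := Matroid.topCount_le_corank_five (M := M) hd hR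
    have h4 := Matroid.ncard_four_sets_eRk_le_three (M := M) hcirc
    rw [hEcard] at h4
    have h5 := Matroid.ncard_five_sets_eRk_le_three_core_sharp (M := M) hs hfree hcirc hd
    rw [← hn_def] at h
    have h' : (Matroid.circuitsEq M 3).ncard * n ≤ 25 * n := Nat.mul_le_mul_right n hs3
    omega
  have hY : 2 ^ n ≤ Matroid.midCount M p 3 +
      ((∑ j ∈ Finset.range 4, n.choose j) + (25 * n + 70) + 4050) +
      (∑ j ∈ Finset.range 6, n.choose j) := by
    have h := Matroid.two_pow_le_midCount_add (M := M) p 3 hR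
    have hA := Matroid.ncard_eRk_le_three_le_core_sharp (M := M) hs hfree hcirc hd
    have hB := Matroid.ncard_spanning_le (M := M) (d := 5) hd
    rw [hEcard] at h hB
    rw [← hn_def] at hA
    rw [show (5 + 1 : ℕ) = 6 from rfl] at hB
    have h' : (Matroid.circuitsEq M 3).ncard * n ≤ 25 * n := Nat.mul_le_mul_right n hs3
    omega
  have hΦ := phiK_le_two_pow_div p 3
  have hp3 : p + 3 = n - 2 := by omega
  have hchoose : (n - 2).choose p = (n - 2).choose 3 := by
    have hp : p = n - 2 - 3 := by omega
    conv_lhs => rw [hp]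
    exact Nat.choose_symm (by omega)
  rw [hp3, hchoose] at hΦ
  have harith := corank_five_arith_sharp n hn
  have hc : (0 : ℚ) < ((n - 2).choose 3 : ℚ) := by exact_mod_cast Nat.choose_pos (by omega)
  have h1 : ((2 ^ (n - 2) * (n.choose 3 + (25 * n + 70) + 810) +
      (n - 2).choose 3 * ((∑ j ∈ Finset.range 4, n.choose j) + (25 * n + 70) + 4050 +
        ∑ j ∈ Finset.range 6, n.choose j) : ℕ) : ℚ) ≤ ((2 ^ n * (n - 2).choose 3 : ℕ) : ℚ) := by
    exact_mod_cast harith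
  have h2 : ((2 ^ n : ℕ) : ℚ) ≤ ((Matroid.midCount M p 3 +
      ((∑ j ∈ Finset.range 4, n.choose j) + (25 * n + 70) + 4050) +
      (∑ j ∈ Finset.range 6, n.choose j) : ℕ) : ℚ) := by exact_mod_cast hY
  have hUq : (Matroid.topCount M p 3 : ℚ) ≤ ((n.choose 3 + (25 * n + 70) + 810 : ℕ) : ℚ) := by
    exact_mod_cast hU
  push_cast at h1 h2 hUq
  have key : (2 : ℚ) ^ (n - 2) * ((n.choose 3 : ℚ) + (25 * n + 70) + 810) ≤
      ((n - 2).choose 3 : ℚ) * (Matroid.midCount M p 3 : ℚ) := by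
    nlinarith [h1, h2, hc]
  calc phiK p 3 * (Matroid.topCount M p 3 : ℚ)
      ≤ ((2 : ℚ) ^ (n - 2) / ((n - 2).choose 3 : ℚ)) * (Matroid.topCount M p 3 : ℚ) :=
        mul_le_mul_of_nonneg_right hΦ (by positivity)
    _ ≤ ((2 : ℚ) ^ (n - 2) / ((n - 2).choose 3 : ℚ)) *
          ((n.choose 3 : ℚ) + (25 * n + 70) + 810) :=
        mul_le_mul_of_nonneg_left hUq (by positivity)
    _ ≤ (Matroid.midCount M p 3 : ℚ) := by
        rw [div_mul_eq_mul_div, div_le_iff₀ hc]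
        linarith [key]

end Matroid

namespace ThmN

/-- **The `d = 5` cell of the `q = 3` row for every `p ≥ 14`, in the form of `SmallCoreCells'`**. -/
theorem c025_core_corank_five_sharp {α : Type} (M : Matroid α) [M.Finite] (p : ℕ) (hp : 14 ≤ p)
    (hs : ∀ e ∈ M.E, ∀ f ∈ M.E, e ≠ f → M.eRk {e, f} = 2) (hrank : M.eRank = (p : ℕ∞))
    (hfree : ∀ e ∈ M.E, ∃ A ⊆ M.E \ {e}, e ∉ M.closure A ∧ e ∉ M.closure ((M.E \ {e}) \ A))
    (hE : M.E.ncard = p + 5) : RLS M p 3 := by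
  have hd : M.E.encard = M.eRank + 5 := by
    rw [← M.ground_finite.cast_ncard_eq, hE, hrank]
    push_cast
    ring
  have hL : ∀ e ∈ M.E, ¬ M.IsLoop e := by
    intro e he hl
    have h2 : 2 ≤ M.E.ncard := by omega
    obtain ⟨f, hf, hfe⟩ : ∃ f ∈ M.E, f ≠ e := by
      by_contra hcon
      push Not at hcon
      have : M.E ⊆ {e} := fun x hx => by simpa using hcon x hx
      have := Set.ncard_le_ncard this (Set.finite_singleton e)
      rw [Set.ncard_singleton] at this
      omega
    have h := hs e he f hf (Ne.symm hfe)
    have hle : M.eRk {e, f} ≤ M.eRk {e} + M.eRk {f} := by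
      rw [Set.insert_eq]
      exact M.eRk_union_le_eRk_add_eRk _ _
    rw [hl.eRk_eq, zero_add, h] at hle
    exact absurd (hle.trans (M.eRk_singleton_le f)) (by norm_num)
  have hcirc : ∀ C, M.IsCircuit C → 3 ≤ C.encard := three_le_encard_of_circuit M hL hs
  rw [RLS_iff]
  exact Matroid.c025_core_corank_five_simple_sharp M p (by omega) hd hrank hs hfree hcirc

end ThmN

end PercRepro
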